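import Summits.AnomalousDissipation.AnomalousDissipation.Theorems.SolenoidalFractalHomogenisationLagrangianStepVmodLossAdjOnsetWindow
import Summits.AnomalousDissipation.AnomalousDissipation.Theorems.SolenoidalFractalHomogenisationLagrangianStepVmodLossAdjOnsetGBound
import Summits.AnomalousDissipation.AnomalousDissipation.Theorems.SolenoidalFractalHomogenisationLagrangianStepVmodCorrectedTestGradLower
import HarnessLib

/-!
# K1L_D (stmt-AnomalousDissipation-27980), (ℓ3-A) road A, (S2-adj): the EXPLICIT sup-norm onset bound of the adjoint loss of the coarse member at a
# corrected test — `2c·m·τ − N·M·τ² ≤ lossAdj (T s t₀) [J(t₀)•φ₀]` with `m`, `M` in the layer norms of `φ₀`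
(helper; `--supports 27980 --as helper`; prover ad-k1loc-p3 g12; composition of p733228 `lossAdj_ge_onsetWindow` with the two sizings p733673
`IsFrameRegular.eLpNorm_onsetG_le` (`M`) and p733987 `IsFrameRegular.gradNormSq_correctedTest_ge` (`m`); `N` stays the a.e. generator bound of the
corrected test along `(0, 𝔸T, G)`, supplied by p727884 `IsFrameRegular.hN_correctedTest` with `b = 0`.)

CONVENTION (D28-8′): derivative-index distortion `Torus.Visc4.conj`; constraint `∇·(G v) = 0`.

**`EnergyDuhamelG.lossAdj_ge_onset_explicit`**: for every `s ∈ [0,t₀)` and `0 ≤ τ ≤ t₀ − s`,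
`2·c·m·τ − N·M·τ² ≤ lossAdj (T s t₀) [J(t₀)•φ₀]`,
`c = lo − η − (lo−η+h+h²/η)(3θ)² − h(6θ+9θ²)`, `m = ½(1−18θ)²·gradNormSq φ₀ − 108θ²nC²·∫‖φ₀‖²`,
`M = a₀‖φ₀‖₂ + a₁Σ‖∂φ₀‖₂ + a₂ΣΣ‖∂²φ₀‖₂` (p733673's constants at `|𝔸T| ≤ A`).  This is the HONEST sup-norm form of the (S2-adj) short-row onset bound:
`m > 0` needs `‖∇φ₀‖ ≳ 15·θnC·‖φ₀‖` (FINDING F-p3g12-1); the band-limited improvement goes through T1 (`PassiveVectorWeakGradientHighModePairing`) + T3.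
`sorry`-free; NOT a proof of any block, of K1L_D or of AD; rung F-D1.A0.
-/

set_option linter.dupNamespace false

noncomputable section

namespace Summit.AnomalousDissipation.AnomalousDissipation.Theorems.SolenoidalFractalHomogenisation.LagrangianStep.VmodDist

open Literature.Analysis Literature.Analysis.FluidPDE Literature.Analysis.FunctionSpaces
open MeasureTheory Set Filter Function
open scoped ENNReal NNReal InnerProductSpace
open Summit.AnomalousDissipation.AnomalousDissipation.Theorems.SolenoidalFractalHomogenisation.LagrangianStep.CellClauseMod
open Summit.AnomalousDissipation.AnomalousDissipation.Theorems.SolenoidalFractalHomogenisation.LagrangianStep.CellEnergyT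

variable {Tw θ nC : ℝ} {𝔸U 𝔸T : Torus.Visc4 (Fin 3)} {bU : ℝ → VF} {G J J' : ℝ → UnitAddTorus (Fin 3) → Matrix (Fin 3) (Fin 3) ℝ}
  {U T : ℝ → ℝ → (V2 →L[ℝ] V2)} {φ₀ : VF}

/-- **(S2-adj) EXPLICIT SUP-NORM ONSET BOUND.**  See the module docstring. -/
theorem EnergyDuhamelG.lossAdj_ge_onset_explicit (hED : EnergyDuhamelG Tw 𝔸U 𝔸T bU G U T)
    (hT : IsDistortedPropagator Tw 𝔸T (fun _ _ => 0) G T) (hG : IsFrameModulation θ Tw nC G) (hR : IsFrameRegular θ Tw nC G J)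
    (hθ : θ ≤ 1 / 18) (hnC : 0 ≤ nC)
    (hsolT : ∀ s, 0 ≤ s → s < Tw → ∀ (φ : VF) (hφ : MemLp φ 2 volume), Torus.IsWeaklyDivFree (Torus.distort (G s) φ) → ∃ w : ℝ → VF,
      Torus.IsWeakTensorPassiveVectorDistortedOn 0 (Tw - s) 𝔸T (fun _ _ => 0) (fun τ => G (s + τ)) φ w)
    (hQ : ∀ ξ : Fin 3 → Fin 3 → ℝ, 0 ≤ ∑ l, ∑ i, ∑ c, ∑ e, 𝔸T i c l e * ξ c i * ξ e l)
    {lo hi h η A : ℝ} (h𝔸 : Torus.NearIso 𝔸T lo hi) (hB : Torus.FullBound 𝔸T h) (hh : 0 ≤ h) (hη : 0 < η) (hηlo : η ≤ lo)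
    (hc : 0 ≤ lo - η - (lo - η + h + h ^ 2 / η) * (3 * θ) ^ 2 - h * (2 * (3 * θ) + (3 * θ) ^ 2))
    (hA0 : 0 ≤ A) (hA : ∀ i a j b', |𝔸T i a j b'| ≤ A)
    (hφs : Torus.IsSmooth φ₀) (hφdiv : Torus.IsDivFree φ₀)
    (hJ' : ∀ᵐ t ∂(volume.restrict (Ioo 0 Tw)), ∀ y, HasDerivAt (fun s => J s y) (J' t y) t)
    {N : ℝ} (hN0 : 0 ≤ N)
    (hN : ∀ᵐ τ ∂(volume.restrict (Ioo 0 Tw)),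
      MemLp (fun x => Torus.distort (J' τ) φ₀ x + Torus.convect (fun _ => 0) (Torus.distort (J τ) φ₀) x +
          Torus.viscAdjVar (fun y => Torus.Visc4.conj (G τ y) 𝔸T) (Torus.distort (J τ) φ₀) x) 2 volume ∧
      eLpNorm (fun x => Torus.distort (J' τ) φ₀ x + Torus.convect (fun _ => 0) (Torus.distort (J τ) φ₀) x +
          Torus.viscAdjVar (fun y => Torus.Visc4.conj (G τ y) 𝔸T) (Torus.distort (J τ) φ₀) x) 2 volume ≤ ENNReal.ofReal N)
    {t₀ : ℝ} (ht₀ : 0 < t₀) (ht₀T : t₀ ≤ Tw) {s : ℝ} (hs : s ∈ Ico 0 t₀) {τ : ℝ} (hτ0 : 0 ≤ τ) (hτ : τ ≤ t₀ - s) :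
    2 * (lo - η - (lo - η + h + h ^ 2 / η) * (3 * θ) ^ 2 - h * (2 * (3 * θ) + (3 * θ) ^ 2))
        * ((1 - 18 * θ) ^ 2 / 2 * Torus.gradNormSq φ₀ - 108 * θ ^ 2 * nC ^ 2 * ∫ x, ‖φ₀ x‖ ^ 2) * τ
      - N * ((6 * (27 * ((1 + θ) * A * (1 + θ)) * (81 * (2 * θ * nC ^ 2)) + 81 * ((1 + θ) * A * (θ * nC) + (θ * nC) * A * (1 + θ)) * (27 * (2 * θ * nC))))
              * (eLpNorm φ₀ 2 volume).toReal
            + (6 * (27 * ((1 + θ) * A * (1 + θ)) * (54 * (2 * θ * nC)) + 81 * ((1 + θ) * A * (θ * nC) + (θ * nC) * A * (1 + θ)) * (9 * 2)))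
              * ∑ c, (eLpNorm (Torus.partialDeriv c φ₀) 2 volume).toReal
            + (6 * (27 * ((1 + θ) * A * (1 + θ)) * (9 * 2))) * ∑ c, ∑ e, (eLpNorm (Torus.partialDeriv e (Torus.partialDeriv c φ₀)) 2 volume).toReal)
          * τ ^ 2
      ≤ lossAdj (T s t₀) (((Torus.isSmooth_distort (hR.smooth t₀) hφs).memLp 2).toLp (Torus.distort (J t₀) φ₀)) := by
  have hm : ∀ᵐ σ ∂(volume.restrict (Ioo 0 t₀)),
      (1 - 18 * θ) ^ 2 / 2 * Torus.gradNormSq φ₀ - 108 * θ ^ 2 * nC ^ 2 * ∫ x, ‖φ₀ x‖ ^ 2 ≤ Torus.gradNormSq (Torus.distort (J (t₀ - σ)) φ₀) := by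
    filter_upwards [ae_restrict_mem measurableSet_Ioo] with σ hσ
    exact hR.gradNormSq_correctedTest_ge hG hθ hnC ⟨by linarith [hσ.2], by linarith [hσ.1]⟩ hφs
  have hgM : ∀ᵐ σ ∂(volume.restrict (Ioo 0 t₀)),
      (eLpNorm (fun x => Torus.viscAdjVar (fun y => Torus.Visc4.conj (G (t₀ - σ) y) 𝔸T) (Torus.distort (J (t₀ - σ)) φ₀) x +
        Torus.viscAdjVar (fun y => Torus.Visc4.conj (G (t₀ - σ) y) (Torus.majorTranspose 𝔸T)) (Torus.distort (J (t₀ - σ)) φ₀) x) 2 volume).toReal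
      ≤ (6 * (27 * ((1 + θ) * A * (1 + θ)) * (81 * (2 * θ * nC ^ 2)) + 81 * ((1 + θ) * A * (θ * nC) + (θ * nC) * A * (1 + θ)) * (27 * (2 * θ * nC))))
              * (eLpNorm φ₀ 2 volume).toReal
            + (6 * (27 * ((1 + θ) * A * (1 + θ)) * (54 * (2 * θ * nC)) + 81 * ((1 + θ) * A * (θ * nC) + (θ * nC) * A * (1 + θ)) * (9 * 2)))
              * ∑ c, (eLpNorm (Torus.partialDeriv c φ₀) 2 volume).toReal
            + (6 * (27 * ((1 + θ) * A * (1 + θ)) * (9 * 2))) * ∑ c, ∑ e, (eLpNorm (Torus.partialDeriv e (Torus.partialDeriv c φ₀)) 2 volume).toReal := by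
    filter_upwards [ae_restrict_mem measurableSet_Ioo] with σ hσ
    exact hR.eLpNorm_onsetG_le hG hθ hnC ⟨by linarith [hσ.2], by linarith [hσ.1]⟩ 𝔸T hA0 hA hφs
  exact hED.lossAdj_ge_onsetWindow hT hG hR hsolT hQ h𝔸 hB hh hη hηlo hc hφs hφdiv hJ' hN0 hN ht₀ ht₀T hm hgM hs hτ0 hτ

end Summit.AnomalousDissipation.AnomalousDissipation.Theorems.SolenoidalFractalHomogenisation.LagrangianStep.VmodDist

end
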